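import Summits.QuantumFields.YangMills.Theorems.MirrorModularBoostsCurvatureBoostCovarianceOrbitBandlimit

/-!
# Stub (3ℓ) `stub_orbitBandlimitLocal` — doubled orbit functions are trigonometric polynomials, from LOCAL boost vectors

Line `Sketch` of crux `MirrorModularBoosts.SoftKernelBoostCovariance` (stmt-QuantumFields-14999), registered stub
`stub_orbitBandlimitLocal` of the checked skeleton `Cruxes/SoftKernelBoostCovariance/Lines/Sketch.lean`, proved
VERBATIM.

**Statement.**  For a one-species Schwinger family `S₁` on `ℝ⁴` with the OS package, translation and proper
hypercubic invariance on `⁰𝒮`, reflection positivity in the eight planar frames, the planar cone and the function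
residual `NPointRegular`, GIVEN uniform planar boost vectors for the `e₀`-reconstructions of `S₁` ITSELF (for every
`h : OSReconstructionNoE1 S₁.toLabelled` and every degree `n` a type `N` such that every compactly supported
time-ordered `F` has a local holomorphic vector-valued continuation `V` of `θ ↦ Ψ_{R_θ F}` of exponential type `N`),
the orbit function `θ ↦ 𝔖_{n+m}(R_θ · H)` (`R_θ = planeRot 0 θ`) of every witness `H` of `ΘF* ⊗ G` (`F`, `G`
compactly supported, `e₀`-time-ordered) is a trigonometric polynomial `Σ_{|k| ≤ K} c_k e^{4ikθ}`.

This is the landed Stub 3 `BoostsInheritMirrors.stub_orbitBandlimit`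
(`Theorems/MirrorModularBoostsCurvatureBoostCovarianceOrbitBandlimit.lean`) with its universal first hypothesis
(Stub 4a for ALL families) replaced by the boost-vector statement for the given `S₁` only — which is all its proof
(`OrbitBandlimitFinal.trigPoly_offDiagonal`) ever uses.

**Proof** (`trigPoly_offDiagonal_local`, the 12-line body of the landed `OrbitBandlimitFinal.trigPoly_offDiagonal`
with the local hypothesis): assemble `h : OSReconstructionNoE1` from E2 (in `OSPackage`) and `Translations`; feed the
local boost vectors at `h` to `stub_orbitLocalContinuation` (Stub 3d: local continuation of the orbit function near
the angle `0`, uniform type `Nₑ`); `stub_orbitAllAngles` (Stub 3c, the quarter turn in `Hypercubic`) moves it to every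
angle on the algebraic generic set `OrbitBandlimitFinal.exists_generic_set`; `stub_orbitGluing` (Stub 3a) glues to an
entire `π/2`-periodic function of type `Nₑ`; `OrbitBandlimitFinal.orbit_trigPoly_of_entire_deg` (Paley–Wiener) gives
degree `⌈Nₑ/4⌉₊`; `stub_orbitGenericUpgrade` (Stub 3b) upgrades from the generic set to all off-diagonal `H`, in
particular to the doubled witnesses (`OrbitBandlimitFinal.isOffDiagonal_of_isAppendTensorOf`).

References: K. Osterwalder, R. Schrader, Comm. Math. Phys. 31 (1973) §4; 42 (1975) §IV–V; R. P. Boas, *Entire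
Functions* (1954) ch. 6 (Paley–Wiener).  No `def`; one helper theorem.
-/

noncomputable section

namespace Summit.QuantumFields.YangMills.Theorems.SoftKernelBoostCovariance.Sketch

open scoped BigOperators SchwartzMap
open MeasureTheory Filter Topology
open Literature.MathematicalPhysics.QuantumLattice Literature.MathematicalPhysics.AQFT
  Literature.MathematicalPhysics.QuantumFieldTheory
open Summit.QuantumFields.YangMills.Theorems.NPointIsotropy.Negative (E4 NPointRegular)
open Summit.QuantumFields.YangMills.Theorems.CurvatureBoostCovariance.Negative
  (OSPackage Translations Hypercubic EightFrameRP PlanarCone)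
open Summit.QuantumFields.YangMills.Theorems.CurvatureBoostCovariance.BoostsInheritMirrors
  (stub_orbitLocalContinuation stub_orbitGenericUpgrade stub_orbitGluing stub_orbitAllAngles)
open Summit.QuantumFields.YangMills.Theorems.CurvatureBoostCovariance.BoostsInheritMirrors.OrbitBandlimitFinal
  (orbit_trigPoly_of_entire_deg lt_four_mul_ceil isOffDiagonal_of_isAppendTensorOf exists_generic_set)
open Summit.QuantumFields.YangMills.Theorems.CurvatureBoostCovariance.BoostsInheritMirrors.OrbitBandlimit
  (orbit_add_pi_div_two)

/-- **The band limit on all off-diagonal test functions, with a UNIFORM degree, from LOCAL uniform planar boost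
vectors.**  For a family `S₁` with the OS package, translations, proper hypercubic invariance and the function
residual, GIVEN uniform planar boost vectors for every `e₀`-reconstruction of `S₁` itself, in every degree `N` there
is `K = K(S₁, N)` such that the orbit function of EVERY off-diagonal `H` of degree `N` is a trigonometric polynomial
`∑_{|k| ≤ K} c_k e^{4ikθ}` (the body of the landed `OrbitBandlimitFinal.trigPoly_offDiagonal`, with the universal
Stub 4a replaced by the local hypothesis at the reconstruction `h` assembled from E2 and `Translations`; the eight
frames and the planar cone are not needed in this local form). -/
theorem trigPoly_offDiagonal_local (S₁ : SchwingerFamily E4) (hOS : OSPackage S₁) (htr : Translations S₁)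
    (hhyp : Hypercubic S₁) (hreg : NPointRegular S₁)
    (hloc : ∀ (h : OSReconstructionNoE1 S₁.toLabelled), ∀ (n : ℕ), ∃ N : ℝ,
      ∀ (F : SchwartzMap (Fin n → E4) ℂ), IsTimeOrdered F → HasCompactSupport (F : (Fin n → E4) → ℂ) →
        ∃ ε : ℝ, 0 < ε ∧ ∃ (V : ℂ → h.Hilbert) (C : ℝ),
          DifferentiableOn ℂ V {θ : ℂ | |θ.re| < ε} ∧
          (∀ θ : ℂ, |θ.re| < ε → ‖V θ‖ ≤ C * Real.exp (N * |θ.im|)) ∧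
          ∀ θ : ℝ, |θ| < ε → ∀ hθ : IsTimeOrdered (linActMulti (planeRot (0 : Fin 3) θ) F),
            V θ = h.fieldVec n (fun _ => ()) (linActMulti (planeRot (0 : Fin 3) θ) F) hθ)
    (N : ℕ) :
    ∃ K : ℕ, ∀ H : 𝓢((Fin N → E4), ℂ), IsOffDiagonal H → ∃ c : ℤ → ℂ, ∀ θ : ℝ,
      S₁ N (linActMulti (planeRot (0 : Fin 3) θ) H) =
        ∑ k ∈ Finset.Icc (-(K : ℤ)) K, c k * Complex.exp (4 * (k : ℂ) * (θ : ℂ) * Complex.I) := by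
  -- adapted from Theorems/MirrorModularBoostsCurvatureBoostCovarianceOrbitBandlimit.lean
  -- (`OrbitBandlimitFinal.trigPoly_offDiagonal`), with the local hypothesis `hloc h` in place of Stub 4a
  obtain ⟨-, -, -, hRP, hsym, -⟩ := hOS
  have h : OSReconstructionNoE1 S₁.toLabelled := ⟨hRP, fun n _ a X hX => htr n a X hX⟩
  obtain ⟨Nₑ, hNₑ⟩ := stub_orbitLocalContinuation S₁ h hsym (hloc h) N
  obtain ⟨W, hW⟩ := hreg N
  obtain ⟨G, hGo, hG0, hGc, hGg⟩ := exists_generic_set N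
  refine ⟨⌈Nₑ / 4⌉₊, fun H hH =>
    stub_orbitGenericUpgrade N (S₁ N) W hW G hGo hG0 hGc _ (fun X hXG hXc => ?_) H hH⟩
  have hXoff : IsOffDiagonal X := IsOffDiagonal.of_tsupport_subset (hXG.trans hGc)
  obtain ⟨Φ, C, hΦd, hΦg, hΦr⟩ := stub_orbitGluing
    (fun θ => S₁ N (linActMulti (planeRot (0 : Fin 3) θ) X)) Nₑ
    (stub_orbitAllAngles N S₁ hhyp Nₑ hNₑ X hXc fun x hx φ => hGg x (hXG hx) φ)
    (fun s => orbit_add_pi_div_two hhyp hXoff s)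
  exact orbit_trigPoly_of_entire_deg hhyp hXoff Φ C Nₑ hΦd hΦg hΦr _ (lt_four_mul_ceil Nₑ)

/-- **Stub (3ℓ) — DOUBLED ORBIT FUNCTIONS ARE TRIGONOMETRIC POLYNOMIALS, from boost vectors of `S₁` ITSELF; the
registered signature VERBATIM.**  The landed `stub_orbitBandlimit`
(`Theorems/MirrorModularBoostsCurvatureBoostCovarianceOrbitBandlimit.lean`) with its universal first hypothesis
(Stub 4a for ALL families) replaced by uniform planar boost vectors for the `e₀`-reconstructions of the given `S₁`
only: for a one-species family with the OS package, translation and proper hypercubic invariance on `⁰𝒮`, E2 in the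
eight planar frames, the planar cone and the function residual, the orbit function `θ ↦ 𝔖_{n+m}(planeRot 0 θ · H)`
of every witness `H` of `ΘF* ⊗ G` (`F`, `G` compactly supported, `e₀`-time-ordered) is a trigonometric polynomial
`Σ_{|k| ≤ K} c_k e^{4ikθ}` (`trigPoly_offDiagonal_local` at the off-diagonal `H`; the degree is even uniform in `H`). -/
theorem stub_orbitBandlimitLocal :
    open Literature.MathematicalPhysics.QuantumLattice Literature.MathematicalPhysics.AQFT
      Literature.MathematicalPhysics.QuantumFieldTheory
      Summit.QuantumFields.YangMills.Theorems.CurvatureBoostCovariance.Negative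
      Summit.QuantumFields.YangMills.Theorems.NPointIsotropy.Negative in
    ∀ (S₁ : SchwingerFamily E4), OSPackage S₁ → Translations S₁ → Hypercubic S₁ → EightFrameRP S₁ →
      PlanarCone S₁ → NPointRegular S₁ →
      (∀ (h : OSReconstructionNoE1 S₁.toLabelled), ∀ (n : ℕ), ∃ N : ℝ, ∀ (F : SchwartzMap (Fin n → E4) ℂ), IsTimeOrdered F →
          HasCompactSupport (F : (Fin n → E4) → ℂ) →
          ∃ ε : ℝ, 0 < ε ∧ ∃ (V : ℂ → h.Hilbert) (C : ℝ),
            DifferentiableOn ℂ V {θ : ℂ | |θ.re| < ε} ∧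
            (∀ θ : ℂ, |θ.re| < ε → ‖V θ‖ ≤ C * Real.exp (N * |θ.im|)) ∧
            ∀ θ : ℝ, |θ| < ε → ∀ hθ : IsTimeOrdered (linActMulti (planeRot (0 : Fin 3) θ) F),
              V θ = h.fieldVec n (fun _ => ()) (linActMulti (planeRot (0 : Fin 3) θ) F) hθ) →
      ∀ (n m : ℕ) (F : SchwartzMap (Fin n → E4) ℂ) (G : SchwartzMap (Fin m → E4) ℂ),
        IsTimeOrdered F → IsTimeOrdered G →
        HasCompactSupport (F : (Fin n → E4) → ℂ) → HasCompactSupport (G : (Fin m → E4) → ℂ) →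
        ∀ H : SchwartzMap (Fin (n + m) → E4) ℂ, IsAppendTensorOf H (osAdjoint F) G →
          ∃ (K : ℕ) (c : ℤ → ℂ), ∀ θ : ℝ,
            S₁ (n + m) (linActMulti (planeRot (0 : Fin 3) θ) H) =
              ∑ k ∈ Finset.Icc (-(K : ℤ)) K, c k * Complex.exp (4 * (k : ℂ) * (θ : ℂ) * Complex.I) := by
  intro S₁ hOS htr hhyp _ _ hreg hloc n m F G hF hG _ _ H hH
  obtain ⟨K, hK⟩ := trigPoly_offDiagonal_local S₁ hOS htr hhyp hreg hloc (n + m)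
  exact ⟨K, hK H (isOffDiagonal_of_isAppendTensorOf hF hG hH)⟩

end Summit.QuantumFields.YangMills.Theorems.SoftKernelBoostCovariance.Sketch

end
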